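import Summits.ValiantsHypothesis.ValiantsHypothesis.Theses.DivisionGap
import Summits.ValiantsHypothesis.ValiantsHypothesis.Theorems.ZeroOneTransfer.Negative.TopComponentFree
import Summits.ValiantsHypothesis.ValiantsHypothesis.Theorems.PerDivisionHard.Negative.LoadBearing
import Summits.ValiantsHypothesis.ValiantsHypothesis.Theorems.PerDivisionHard.Negative.VarsCounting
import Literature.Computability.AlgebraicComplexity.PermanentIrreducible

/-!
# `DivisionGap.PerDivisionHard` (stmt-ValiantsHypothesis-5065), line `pair-descent-jss-endpoint`:
which hypotheses of the face-descent stub are load-bearing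

Standing-disprover output (cdisprove cycle 2) for the PICKED line of the crux
(`Cruxes/PerDivisionHard/Lines/pair-descent-jss-endpoint.lean`, lead `prover-line-…-5065-0`).
The line's notions are restated INLINE (the skeleton is a sorried workfile and cannot be imported):
`CutsOut w G := ∀ σ, (∀ i, (σ i, i) ∈ G) ↔ ∀ τ, Σ_i w(τ i, i) ≤ Σ_i w(σ i, i)`,
`HasSingleGPart G w h u := supp u ⊆ G ∧ ∀ m ∈ supp(top_w h), ∀ e ∈ G, m e = u e`
(`top_w` = the tree's `ZeroOneTransfer.Negative.topComponent`),
`facePer G := Σ_{σ inside G} monomial (permMonomial σ) 1`.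

* `hasSingleGPart_zero` — `HasSingleGPart G w 0 u` holds for every `u` supported in `G`: the
  single-`G`-part condition is VACUOUS at `h = 0` (it does not assert that the fibre is inhabited).
  So in the open stub `stub_noCheapOmnipresence` the hypothesis `h ≠ 0` is not used by the
  conclusion's last clause (information for the lead: it is needed only through `stub_faceDescent`).
* `stub_faceDescent_false_without_nonzero` — consequently `stub_faceDescent` with its hypothesis
  `h ≠ 0` deleted is FALSE: `n = 2`, `G = everything`, `w = 0` (cuts out `G`: all permutations lie
  in `G` and all have weight `0`), `h = 0`, `u = 0` would give `L(per₂) ≤ L(per₂ · 0) + 1 = 1`,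
  while `L(per₂) ≥ 2` by the variable-counting floor (`Negative/VarsCounting.sq_le_of_pair`).
  Any proof of the stub must use `h ≠ 0` (it enters as `a = Σ coeff(top_w h) ≠ 0`).

No stub of the line is refuted; see `Cruxes/PerDivisionHard/Disproof.lean`, section
"Line pair-descent-jss-endpoint", for the stub-by-stub analysis and the profile a counterexample to
the open stub K2 would need.
-/

noncomputable section

namespace Summit.ValiantsHypothesis.Theorems.PerDivisionHardNegative

open Literature.Computability.AlgebraicComplexity MvPolynomial
open Summit.ValiantsHypothesis.ValiantsHypothesis.Theorems.ZeroOneTransfer.Negative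
  (topComponent topComponent_zero)
open scoped NNReal

/-- The single-`G`-part clause of the line is vacuous at `h = 0`. [folklore] -/
theorem hasSingleGPart_zero {n : ℕ} (G : Finset (Fin n × Fin n)) (w : Fin n × Fin n → ℕ)
    (u : (Fin n × Fin n) →₀ ℕ) (hu : u.support ⊆ G) :
    u.support ⊆ G ∧ ∀ m ∈ (topComponent w (0 : MvPolynomial (Fin n × Fin n) ℝ≥0)).support,
      ∀ e ∈ G, m e = u e := by
  refine ⟨hu, ?_⟩
  intro m hm
  simp [topComponent_zero] at hm

/-- **`h ≠ 0` is load-bearing in `stub_faceDescent`.** The stub with the hypothesis `h ≠ 0`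
deleted is false (witness `n = 2`, `G = univ`, `w = 0`, `h = 0`, `u = 0`). [folklore] -/
theorem stub_faceDescent_false_without_nonzero :
    ¬ ∀ (n : ℕ) (G : Finset (Fin n × Fin n)) (w : Fin n × Fin n → ℕ)
        (h : MvPolynomial (Fin n × Fin n) ℝ≥0) (u : (Fin n × Fin n) →₀ ℕ),
        (∀ σ : Equiv.Perm (Fin n),
          (∀ i, (σ i, i) ∈ G) ↔ ∀ τ : Equiv.Perm (Fin n), (∑ i, w (τ i, i)) ≤ ∑ i, w (σ i, i)) →
        (u.support ⊆ G ∧ ∀ m ∈ (topComponent w h).support, ∀ e ∈ G, m e = u e) →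
        complexity (monomial u (1 : ℝ≥0) *
            ∑ σ ∈ (Finset.univ : Finset (Equiv.Perm (Fin n))).filter (fun σ => ∀ i, (σ i, i) ∈ G),
              monomial (permMonomial σ) (1 : ℝ≥0)) ≤
          complexity (perPoly (Fin n) ℝ≥0 * h) + 1 := by
  intro H
  have hcut : ∀ σ : Equiv.Perm (Fin 2),
      (∀ i, (σ i, i) ∈ (Finset.univ : Finset (Fin 2 × Fin 2))) ↔
        ∀ τ : Equiv.Perm (Fin 2), (∑ i, (fun _ : Fin 2 × Fin 2 => (0 : ℕ)) (τ i, i)) ≤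
          ∑ i, (fun _ : Fin 2 × Fin 2 => (0 : ℕ)) (σ i, i) := by
    intro σ; simp
  have hsingle := hasSingleGPart_zero (Finset.univ : Finset (Fin 2 × Fin 2)) (fun _ => 0) 0
    (by simp)
  have h := H 2 Finset.univ (fun _ => 0) 0 0 hcut hsingle
  -- the face polynomial of the full face is the permanent
  have hface : (∑ σ ∈ (Finset.univ : Finset (Equiv.Perm (Fin 2))).filter
      (fun σ => ∀ i, (σ i, i) ∈ (Finset.univ : Finset (Fin 2 × Fin 2))),
        monomial (permMonomial σ) (1 : ℝ≥0)) = perPoly (Fin 2) ℝ≥0 := by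
    rw [Finset.filter_true_of_mem (fun σ _ i => Finset.mem_univ _), perPoly_eq_sum_monomial]
  have hmon : (monomial (0 : (Fin 2 × Fin 2) →₀ ℕ) (1 : ℝ≥0)) = 1 := rfl
  rw [hface, hmon, one_mul, mul_zero, complexity_zero, zero_add] at h
  -- but `L(per₂) ≥ 2` by the variable-counting floor
  have hfloor := sq_le_of_pair (n := 2) (h := (1 : MvPolynomial (Fin 2 × Fin 2) ℝ≥0)) one_ne_zero
  rw [mul_one] at hfloor
  omega

end Summit.ValiantsHypothesis.Theorems.PerDivisionHardNegative

end
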